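import Mathlib
import HarnessLib

/-!
# Crux `UnitSpeedTwoPoint` — stub C `stub_conePushforward` (line `yukawa_subordination`)

Crux stmt-CriticalPhenomena-17167 (`Theses.UnitLightCone.UnitSpeedTwoPoint`), line
`yukawa_subordination`, registered stub C: **the cone pushforward**.  For every s-finite
measure `ν` on `ℝ` carried by `[0, ∞)` with `m ↦ e^{-mr}` integrable for all `r > 0`, and every
mass family obeying the Sommerfeld–Weyl conclusion of stub B (taken as a HYPOTHESIS), there is
a measure `μ` on `ℝ² × ℝ` giving zero mass to the spacelike region `{ω < |k|}` with
`∫ cos(k₀a + k₁b) e^{-ω|t|} dμ(k, ω) = ∫ e^{-mr}/r dν(m)` for all `a b` and `t ≠ 0`,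
`r = √(a² + b² + t²)`.

Proof.  Witness (mass coordinate first, `E = EuclideanSpace ℝ (Fin 2)`):
`μ = Measure.map (fun q => (q.2, √(‖q.2‖² + q.1²)))
  ((ν.prod volume).withDensity (fun q => ENNReal.ofReal ((2π)⁻¹ / √(‖q.2‖² + q.1²))))`
on `ℝ × E`.  The support clause is the measure of the EMPTY preimage `{√(‖k‖² + m²) < ‖k‖}`
(`conePushforward_norm_le_sqrt`).  The formula is `integral_map` +
`integral_withDensity_eq_integral_toReal_smul` + Fubini (`integral_prod`; integrability
through `integrable_prod_iff`: the sections are integrable by the hypothesis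
(`conePushforward_integrable_section`), and `m ↦ ∫ |integrand| d²k ≤ e^{-m|t|}/|t|` by the
hypothesis at `a = b = 0` (`conePushforward_integral_norm_le`), which is `ν`-integrable), and
the inner integral is the hypothesis up to the constant `(2π)⁻¹`
(`conePushforward_inner_integral`), valid for `m ≥ 0`, i.e. `ν`-a.e. since `ν (Iio 0) = 0`.

References: J. Glimm, A. Jaffe, *Quantum Physics* (1987) §6.2 (Källén–Lehmann as a
superposition of free covariances); M. Reed, B. Simon, *Methods of Modern Mathematical
Physics II* §IX.8.  All steps are standard measure theory [folklore].
-/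

noncomputable section

open MeasureTheory

namespace Summit.CriticalPhenomena.Ising3DConformalLimit.Cruxes.UnitSpeedTwoPoint.YukawaSubordination

/-- The dispersion relation lies on or inside the forward cone: `‖k‖ ≤ √(‖k‖² + m²)`.
[folklore] -/
theorem conePushforward_norm_le_sqrt (k : EuclideanSpace ℝ (Fin 2)) (m : ℝ) :
    ‖k‖ ≤ Real.sqrt (‖k‖ ^ 2 + m ^ 2) :=
  Real.le_sqrt_of_sq_le (le_add_of_nonneg_right (sq_nonneg m))

/-- Pointwise bound on the weighted integrand (`|cos| ≤ 1`):
`‖(2π)⁻¹/Ω · (cos(…) · e^{-Ω|t|})‖ ≤ (2π)⁻¹ · (e^{-Ω|t|}/Ω)`, `Ω = √(‖k‖² + m²)`. [folklore] -/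
theorem conePushforward_norm_integrand_le (k : EuclideanSpace ℝ (Fin 2)) (m t a b : ℝ) :
    ‖(2 * Real.pi)⁻¹ / Real.sqrt (‖k‖ ^ 2 + m ^ 2) *
        (Real.cos (k 0 * a + k 1 * b) * Real.exp (-(Real.sqrt (‖k‖ ^ 2 + m ^ 2) * |t|)))‖ ≤
      (2 * Real.pi)⁻¹ * (Real.exp (-(Real.sqrt (‖k‖ ^ 2 + m ^ 2) * |t|)) /
        Real.sqrt (‖k‖ ^ 2 + m ^ 2)) := by
  have hc : 0 ≤ (2 * Real.pi)⁻¹ / Real.sqrt (‖k‖ ^ 2 + m ^ 2) := by positivity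
  rw [Real.norm_eq_abs, abs_mul, abs_mul, abs_of_nonneg hc, abs_of_nonneg (Real.exp_pos _).le]
  calc (2 * Real.pi)⁻¹ / Real.sqrt (‖k‖ ^ 2 + m ^ 2) *
        (|Real.cos (k 0 * a + k 1 * b)| * Real.exp (-(Real.sqrt (‖k‖ ^ 2 + m ^ 2) * |t|)))
      ≤ (2 * Real.pi)⁻¹ / Real.sqrt (‖k‖ ^ 2 + m ^ 2) *
        (1 * Real.exp (-(Real.sqrt (‖k‖ ^ 2 + m ^ 2) * |t|))) := by
        gcongr
        exact Real.abs_cos_le_one _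
    _ = _ := by ring

/-- Section integrability: if `k ↦ e^{-Ω|t|}/Ω` is integrable on `ℝ²` then so is the weighted
integrand `k ↦ (2π)⁻¹/Ω · (cos(k₀a + k₁b) · e^{-Ω|t|})` (bounded continuous factor).
[folklore] -/
theorem conePushforward_integrable_section {m t : ℝ} (a b : ℝ)
    (hI : Integrable (fun k : EuclideanSpace ℝ (Fin 2) =>
      Real.exp (-(Real.sqrt (‖k‖ ^ 2 + m ^ 2) * |t|)) / Real.sqrt (‖k‖ ^ 2 + m ^ 2))) :
    Integrable (fun k : EuclideanSpace ℝ (Fin 2) =>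
      (2 * Real.pi)⁻¹ / Real.sqrt (‖k‖ ^ 2 + m ^ 2) *
        (Real.cos (k 0 * a + k 1 * b) * Real.exp (-(Real.sqrt (‖k‖ ^ 2 + m ^ 2) * |t|)))) := by
  have h : (fun k : EuclideanSpace ℝ (Fin 2) =>
      (2 * Real.pi)⁻¹ / Real.sqrt (‖k‖ ^ 2 + m ^ 2) *
        (Real.cos (k 0 * a + k 1 * b) * Real.exp (-(Real.sqrt (‖k‖ ^ 2 + m ^ 2) * |t|)))) =
      fun k : EuclideanSpace ℝ (Fin 2) => Real.cos (k 0 * a + k 1 * b) * ((2 * Real.pi)⁻¹ *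
        (Real.exp (-(Real.sqrt (‖k‖ ^ 2 + m ^ 2) * |t|)) / Real.sqrt (‖k‖ ^ 2 + m ^ 2))) := by
    funext k; ring
  rw [h]
  refine (hI.const_mul _).bdd_mul (c := 1) ?_ (ae_of_all _ fun k => ?_)
  · exact (by fun_prop : Continuous fun k : EuclideanSpace ℝ (Fin 2) =>
      Real.cos (k 0 * a + k 1 * b)).aestronglyMeasurable
  · rw [Real.norm_eq_abs]
    exact Real.abs_cos_le_one _

/-- The inner (momentum) integral: the Sommerfeld–Weyl identity for the mass `m`, divided by
`2π`, is `∫ (2π)⁻¹/Ω · cos(k₀a + k₁b) e^{-Ω|t|} d²k = e^{-mr}/r`, `r = √(a² + b² + t²)`.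
[folklore] -/
theorem conePushforward_inner_integral {m t a b : ℝ}
    (hV : ∫ k : EuclideanSpace ℝ (Fin 2), Real.cos (k 0 * a + k 1 * b) *
        (Real.exp (-(Real.sqrt (‖k‖ ^ 2 + m ^ 2) * |t|)) / Real.sqrt (‖k‖ ^ 2 + m ^ 2)) =
      2 * Real.pi * Real.exp (-(m * Real.sqrt (a ^ 2 + b ^ 2 + t ^ 2))) /
        Real.sqrt (a ^ 2 + b ^ 2 + t ^ 2)) :
    ∫ k : EuclideanSpace ℝ (Fin 2), (2 * Real.pi)⁻¹ / Real.sqrt (‖k‖ ^ 2 + m ^ 2) *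
        (Real.cos (k 0 * a + k 1 * b) * Real.exp (-(Real.sqrt (‖k‖ ^ 2 + m ^ 2) * |t|))) =
      Real.exp (-(m * Real.sqrt (a ^ 2 + b ^ 2 + t ^ 2))) /
        Real.sqrt (a ^ 2 + b ^ 2 + t ^ 2) := by
  have h : ∀ k : EuclideanSpace ℝ (Fin 2), (2 * Real.pi)⁻¹ / Real.sqrt (‖k‖ ^ 2 + m ^ 2) *
      (Real.cos (k 0 * a + k 1 * b) * Real.exp (-(Real.sqrt (‖k‖ ^ 2 + m ^ 2) * |t|))) =
      (2 * Real.pi)⁻¹ * (Real.cos (k 0 * a + k 1 * b) *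
        (Real.exp (-(Real.sqrt (‖k‖ ^ 2 + m ^ 2) * |t|)) / Real.sqrt (‖k‖ ^ 2 + m ^ 2))) := by
    intro k; ring
  have hπ : (2 * Real.pi) ≠ 0 := by positivity
  simp_rw [h]
  rw [integral_const_mul, hV]
  calc (2 * Real.pi)⁻¹ * (2 * Real.pi * Real.exp (-(m * Real.sqrt (a ^ 2 + b ^ 2 + t ^ 2))) /
        Real.sqrt (a ^ 2 + b ^ 2 + t ^ 2))
      = (2 * Real.pi)⁻¹ * (2 * Real.pi) * Real.exp (-(m * Real.sqrt (a ^ 2 + b ^ 2 + t ^ 2))) /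
        Real.sqrt (a ^ 2 + b ^ 2 + t ^ 2) := by ring
    _ = _ := by rw [inv_mul_cancel₀ hπ, one_mul]

/-- The norm-integral bound feeding Fubini: by `|cos| ≤ 1` and the Sommerfeld–Weyl identity at
`a = b = 0` (where `r = |t|`), `∫ ‖(2π)⁻¹/Ω · cos(…) e^{-Ω|t|}‖ d²k ≤ e^{-m|t|}/|t|`.
[folklore] -/
theorem conePushforward_integral_norm_le {m t : ℝ} (a b : ℝ)
    (hI : Integrable (fun k : EuclideanSpace ℝ (Fin 2) =>
      Real.exp (-(Real.sqrt (‖k‖ ^ 2 + m ^ 2) * |t|)) / Real.sqrt (‖k‖ ^ 2 + m ^ 2)))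
    (hV : ∫ k : EuclideanSpace ℝ (Fin 2), Real.cos (k 0 * 0 + k 1 * 0) *
        (Real.exp (-(Real.sqrt (‖k‖ ^ 2 + m ^ 2) * |t|)) / Real.sqrt (‖k‖ ^ 2 + m ^ 2)) =
      2 * Real.pi * Real.exp (-(m * Real.sqrt (0 ^ 2 + 0 ^ 2 + t ^ 2))) /
        Real.sqrt (0 ^ 2 + 0 ^ 2 + t ^ 2)) :
    ∫ k : EuclideanSpace ℝ (Fin 2), ‖(2 * Real.pi)⁻¹ / Real.sqrt (‖k‖ ^ 2 + m ^ 2) *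
        (Real.cos (k 0 * a + k 1 * b) * Real.exp (-(Real.sqrt (‖k‖ ^ 2 + m ^ 2) * |t|)))‖ ≤
      Real.exp (-(m * |t|)) / |t| := by
  have ht2 : Real.sqrt (0 ^ 2 + 0 ^ 2 + t ^ 2) = |t| := by
    rw [show (0 : ℝ) ^ 2 + 0 ^ 2 + t ^ 2 = t ^ 2 by ring, Real.sqrt_sq_eq_abs]
  simp only [mul_zero, add_zero, Real.cos_zero, one_mul, ht2] at hV
  have hπ : (2 * Real.pi) ≠ 0 := by positivity
  calc ∫ k : EuclideanSpace ℝ (Fin 2), ‖(2 * Real.pi)⁻¹ / Real.sqrt (‖k‖ ^ 2 + m ^ 2) *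
        (Real.cos (k 0 * a + k 1 * b) * Real.exp (-(Real.sqrt (‖k‖ ^ 2 + m ^ 2) * |t|)))‖
      ≤ ∫ k : EuclideanSpace ℝ (Fin 2), (2 * Real.pi)⁻¹ *
        (Real.exp (-(Real.sqrt (‖k‖ ^ 2 + m ^ 2) * |t|)) / Real.sqrt (‖k‖ ^ 2 + m ^ 2)) :=
        integral_mono_of_nonneg (ae_of_all _ fun _ => norm_nonneg _) (hI.const_mul _)
          (ae_of_all _ fun k => conePushforward_norm_integrand_le k m t a b)
    _ = Real.exp (-(m * |t|)) / |t| := by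
        rw [integral_const_mul, hV]
        calc (2 * Real.pi)⁻¹ * (2 * Real.pi * Real.exp (-(m * |t|)) / |t|)
            = (2 * Real.pi)⁻¹ * (2 * Real.pi) * Real.exp (-(m * |t|)) / |t| := by ring
          _ = _ := by rw [inv_mul_cancel₀ hπ, one_mul]

/-- Registered stub C `stub_conePushforward` — **cone pushforward**: for every s-finite measure
`ν` on `ℝ` carried by `[0,∞)` with `m ↦ e^{-mr}` integrable for all `r > 0`, and every mass
family obeying the Sommerfeld–Weyl conclusion of stub B (a HYPOTHESIS here), there is a measure
`μ` on `ℝ² × ℝ` giving zero mass to the spacelike region `{ω < |k|}` with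
`∫ cos(k₀a + k₁b) e^{-ω|t|} dμ(k, ω) = ∫ e^{-mr}/r dν(m)` for all `a b` and `t ≠ 0`,
`r = √(a² + b² + t²)`.  Witness: the image of `(2πΩ)⁻¹ dν(m) ⊗ d²k` under
`(m, k) ↦ (k, Ω(k, m))`, `Ω = √(‖k‖² + m²) ≥ ‖k‖` (so the spacelike region has EMPTY
preimage); the formula is `integral_map` + `integral_withDensity_eq_integral_toReal_smul` +
Fubini. [folklore] -/
theorem stub_conePushforward :
    ∀ ν : MeasureTheory.Measure ℝ, MeasureTheory.SFinite ν → ν (Set.Iio 0) = 0 →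
      (∀ r : ℝ, 0 < r → MeasureTheory.Integrable (fun m : ℝ => Real.exp (-(m * r))) ν) →
      (∀ m t a b : ℝ, 0 ≤ m → t ≠ 0 →
        MeasureTheory.Integrable (fun k : EuclideanSpace ℝ (Fin 2) =>
            Real.exp (-(Real.sqrt (‖k‖ ^ 2 + m ^ 2) * |t|)) / Real.sqrt (‖k‖ ^ 2 + m ^ 2)) ∧
          ∫ k : EuclideanSpace ℝ (Fin 2), Real.cos (k 0 * a + k 1 * b) *
              (Real.exp (-(Real.sqrt (‖k‖ ^ 2 + m ^ 2) * |t|)) / Real.sqrt (‖k‖ ^ 2 + m ^ 2)) =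
            2 * Real.pi * Real.exp (-(m * Real.sqrt (a ^ 2 + b ^ 2 + t ^ 2))) /
              Real.sqrt (a ^ 2 + b ^ 2 + t ^ 2)) →
      ∃ μ : MeasureTheory.Measure (EuclideanSpace ℝ (Fin 2) × ℝ),
        μ {p : EuclideanSpace ℝ (Fin 2) × ℝ | p.2 < ‖p.1‖} = 0 ∧
          ∀ t a b : ℝ, t ≠ 0 →
            ∫ p, Real.cos (p.1 0 * a + p.1 1 * b) * Real.exp (-(p.2 * |t|)) ∂μ =
              ∫ m, Real.exp (-(m * Real.sqrt (a ^ 2 + b ^ 2 + t ^ 2))) /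
                Real.sqrt (a ^ 2 + b ^ 2 + t ^ 2) ∂ν := by
  intro ν hsf hν0 hνint hB
  haveI := hsf
  -- the mass is `ν`-a.e. nonnegative
  have hae : ∀ᵐ m ∂ν, (0 : ℝ) ≤ m := by
    filter_upwards [measure_eq_zero_iff_ae_notMem.1 hν0] with m hm using not_lt.1 hm
  -- measurability of the cone map and of the density
  have hΦ : Measurable fun q : ℝ × EuclideanSpace ℝ (Fin 2) =>
      (q.2, Real.sqrt (‖q.2‖ ^ 2 + q.1 ^ 2)) :=
    (by fun_prop : Continuous fun q : ℝ × EuclideanSpace ℝ (Fin 2) =>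
      (q.2, Real.sqrt (‖q.2‖ ^ 2 + q.1 ^ 2))).measurable
  have hD : Measurable fun q : ℝ × EuclideanSpace ℝ (Fin 2) =>
      ENNReal.ofReal ((2 * Real.pi)⁻¹ / Real.sqrt (‖q.2‖ ^ 2 + q.1 ^ 2)) := by
    fun_prop
  have hDlt : ∀ᵐ q ∂(ν.prod (volume : Measure (EuclideanSpace ℝ (Fin 2)))),
      ENNReal.ofReal ((2 * Real.pi)⁻¹ / Real.sqrt (‖q.2‖ ^ 2 + q.1 ^ 2)) < ⊤ :=
    ae_of_all _ fun _ => ENNReal.ofReal_lt_top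
  have hDreal : ∀ q : ℝ × EuclideanSpace ℝ (Fin 2),
      (ENNReal.ofReal ((2 * Real.pi)⁻¹ / Real.sqrt (‖q.2‖ ^ 2 + q.1 ^ 2))).toReal =
        (2 * Real.pi)⁻¹ / Real.sqrt (‖q.2‖ ^ 2 + q.1 ^ 2) :=
    fun q => ENNReal.toReal_ofReal (by positivity)
  refine ⟨Measure.map
      (fun q : ℝ × EuclideanSpace ℝ (Fin 2) => (q.2, Real.sqrt (‖q.2‖ ^ 2 + q.1 ^ 2)))
      ((ν.prod (volume : Measure (EuclideanSpace ℝ (Fin 2)))).withDensity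
        fun q : ℝ × EuclideanSpace ℝ (Fin 2) =>
          ENNReal.ofReal ((2 * Real.pi)⁻¹ / Real.sqrt (‖q.2‖ ^ 2 + q.1 ^ 2))), ?_, ?_⟩
  · -- the spacelike region has empty preimage
    have hS : MeasurableSet {p : EuclideanSpace ℝ (Fin 2) × ℝ | p.2 < ‖p.1‖} :=
      measurableSet_lt measurable_snd measurable_fst.norm
    rw [Measure.map_apply hΦ hS]
    have he : (fun q : ℝ × EuclideanSpace ℝ (Fin 2) =>
        (q.2, Real.sqrt (‖q.2‖ ^ 2 + q.1 ^ 2))) ⁻¹'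
          {p : EuclideanSpace ℝ (Fin 2) × ℝ | p.2 < ‖p.1‖} = ∅ := by
      ext q
      simp only [Set.mem_preimage, Set.mem_setOf_eq, Set.mem_empty_iff_false, iff_false,
        not_lt]
      exact conePushforward_norm_le_sqrt q.2 q.1
    rw [he, measure_empty]
  · intro t a b ht
    have htpos : 0 < |t| := abs_pos.2 ht
    -- the weighted integrand on the product `ν ⊗ d²k` is integrable (Fubini–Tonelli criterion)
    have hFm : Measurable fun q : ℝ × EuclideanSpace ℝ (Fin 2) =>
        (2 * Real.pi)⁻¹ / Real.sqrt (‖q.2‖ ^ 2 + q.1 ^ 2) *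
          (Real.cos (q.2 0 * a + q.2 1 * b) *
            Real.exp (-(Real.sqrt (‖q.2‖ ^ 2 + q.1 ^ 2) * |t|))) := by
      fun_prop
    have hFint : Integrable (fun q : ℝ × EuclideanSpace ℝ (Fin 2) =>
        (2 * Real.pi)⁻¹ / Real.sqrt (‖q.2‖ ^ 2 + q.1 ^ 2) *
          (Real.cos (q.2 0 * a + q.2 1 * b) *
            Real.exp (-(Real.sqrt (‖q.2‖ ^ 2 + q.1 ^ 2) * |t|))))
        (ν.prod (volume : Measure (EuclideanSpace ℝ (Fin 2)))) := by
      refine (integrable_prod_iff hFm.aestronglyMeasurable).2 ⟨?_, ?_⟩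
      · filter_upwards [hae] with m hm
        exact conePushforward_integrable_section a b (hB m t a b hm ht).1
      · refine Integrable.mono' ((hνint |t| htpos).div_const |t|)
          hFm.aestronglyMeasurable.norm.integral_prod_right' ?_
        filter_upwards [hae] with m hm
        refine (norm_integral_le_integral_norm _).trans ?_
        simp only [norm_norm]
        exact conePushforward_integral_norm_le a b (hB m t a b hm ht).1 (hB m t 0 0 hm ht).2
    rw [integral_map hΦ.aemeasurable
        (by fun_prop : Continuous fun p : EuclideanSpace ℝ (Fin 2) × ℝ =>
          Real.cos (p.1 0 * a + p.1 1 * b) * Real.exp (-(p.2 * |t|))).aestronglyMeasurable,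
      integral_withDensity_eq_integral_toReal_smul hD hDlt]
    simp only [hDreal, smul_eq_mul]
    rw [integral_prod _ hFint]
    refine integral_congr_ae ?_
    filter_upwards [hae] with m hm
    exact conePushforward_inner_integral (hB m t a b hm ht).2

end Summit.CriticalPhenomena.Ising3DConformalLimit.Cruxes.UnitSpeedTwoPoint.YukawaSubordination

end
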